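import Mathlib.Analysis.Matrix.HermitianFunctionalCalculus
import Mathlib.Analysis.CStarAlgebra.Matrix
import Mathlib.Analysis.CStarAlgebra.Spectrum
import Mathlib.Analysis.Complex.Order
import Mathlib.Data.Real.Sign
import Mathlib.LinearAlgebra.Matrix.PosDef
import Mathlib.Topology.Instances.Matrix
import Mathlib.Topology.UniformSpace.Matrix
import Literature.MathematicalPhysics.QuantumLattice.GrassmannIntegralWilsonProofs
import HarnessLib

/-!
# Neuberger's (massive) overlap Dirac operator on the four-torus

Trunk `Literature/MathematicalPhysics/QuantumLattice`. On top of the tree's gauge-covariant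
Wilson–Dirac operator `wilsonDirac ρ U m r` (site × colour × spin index
`TorusSite 4 L × Fin N × Fin 4`, colour representation `ρ : G →* Matrix (Fin N) (Fin N) ℂ`) and the
chirality matrix `Γ₅ = spinorLift gammaFive`, this file defines, in lattice units `a = 1` and with
Wilson parameter `r = 1`:

* `overlapKernel ρ U m₀ = Γ₅ · D_W(U, -m₀, 1)` — the Hermitian Wilson–Dirac kernel `H = γ₅ X`,
  `X = D_W - m₀` the Wilson–Dirac operator with NEGATIVE mass `-m₀`, `0 < m₀ < 2`
  [Neuberger1998, eqs. (2), (11)]; this is `Q = γ₅(aD_w - 1 - s)` of [GiustiEtAl2002, §2 (2.4)]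
  with `1 + s = m₀`;
* `overlapUnitary ρ U m₀ = V = Γ₅ · ε(H)`, `ε(H) = sign(H) = H/√H²` realised by Mathlib's
  continuous functional calculus `cfc Real.sign` of the Hermitian matrix `H`
  [Neuberger1998, eqs. (8)–(9)];
* `overlapDirac ρ U m₀ μ = (1 + μ/2)·1 + (1 - μ/2)·V` — the MASSIVE overlap operator
  `D_μ = (1 - μ/2) D₀ + μ` built on the massless `D₀ = 1 + V` (`overlapDirac_zero`,
  `overlapDirac_eq_massless_add`). `D₀ = 1 + V` is `2·D` for Neuberger's `D = (1+V)/2`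
  [Neuberger1998, abstract and eq. (8)] and is Lüscher's solution `(1/a){1 - A(A†A)^{-1/2}}`,
  `A = 1 - aD_w`, of the Ginsparg–Wilson relation at `a = 1`, `m₀ = 1` [Luscher1998, (3.2)];
  `D_μ` is literally the massive Neuberger–Dirac operator `D_m = (1 - ām/2)D + m`,
  `D = ā⁻¹(1 + γ₅ sign Q)`, `ā = a/(1+s)` of [GiustiEtAl2002, §2 (2.3)–(2.4)] at `a = 1`, `s = 0`
  (`m₀ = 1`, `m = μ`); for general `m₀` it is `m₀⁻¹ D_m` at bare mass `m = m₀ μ` (the conventional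
  overall factor `m₀ = 1 + s` is NOT included, as requested by the route that inlines this term).

## API (all proved)

Unconditionally: `Γ₅` is a Hermitian involution; `H` is Hermitian for unitary `ρ`
(`overlapKernel_isHermitian`, from the discharged tree fact `wilsonDirac_gammaFive_hermitian`);
`ε(H)` is Hermitian; `V` and every `D_μ` are `Γ₅`-Hermitian (`Γ₅ D_μ Γ₅ = D_μ†`,
`overlapDirac_gammaFive_hermitian`), hence `det D_μ` is real (`overlapDirac_det_im`).
Off the EXCEPTIONAL SET `det H = 0` ("we assume det H ≠ 0" [Neuberger1998, after (8)]):
`ε(H)² = 1` (`overlapSign_mul_self`), `V` is unitary (`overlapUnitary_mem_unitaryGroup`,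
[Neuberger1998, (9)]), its spectrum is unimodular and that of `D₀` lies on the Ginsparg–Wilson
circle `|z - 1| = 1` (`overlapDirac_zero_spectrum`; "all the eigenvalues of V reside on the unit
circle" [Neuberger1998, after (14)]), `D_μ` is normal, `D₀` satisfies the Ginsparg–Wilson relation
`γ₅D + Dγ₅ = D γ₅ D` [GinspargWilson1982] [Luscher1998, (3.1) at a = 1]
(`overlapDirac_ginspargWilson`) and Lüscher's infinitesimal variation
`δψ = γ₅(1 - ½D)ψ, δψ̄ = ψ̄(1 - ½D)γ₅` [Luscher1998, (4.1)] annihilates the action kernel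
(`overlapDirac_luscher_symmetry`); `D_μ† D_μ = μ² + (1 - μ²/4) D₀†D₀ ≥ μ²` for `0 ≤ μ ≤ 2`
(`overlapDirac_conjTranspose_mul_self`, `posSemidef_overlapDirac_sub`: the resolvent bound
`‖D_μ⁻¹‖ ≤ 1/μ`); and `det D_μ > 0` for every `μ > 0`, `det D₀ ≥ 0`
(`overlapDirac_det_re_pos`, `overlapDirac_zero_det_re_nonneg`; [Neuberger1998, (10)]).
The positivity is proved in the ABSTRACT form used by lattice practitioners (sub-namespace
`GinspargWilson`): for `Γ² = 1`, `V` unitary with `Γ V Γ = V†` and reals `|b| < a`,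
`det(a·1 + b·V)` is real and positive — by a homotopy in `b` (the determinant is real, never
vanishes since the spectrum of `V` is unimodular while `a/|b| > 1`, and equals `aⁿ > 0` at `b = 0`)
rather than by the eigenvalue pairing printed in [Neuberger1998, (10)]; same statement.
The exceptional-set hypothesis is not vacuous: on the one-site torus in the trivial gauge field
`D_W(1, m, r) = m·1`, so `det H(m₀) = (-m₀)^{4N} ≠ 0` for `m₀ ≠ 0` (`wilsonDirac_one_oneSite`,
`overlapKernel_det_ne_zero_oneSite`, `overlapDirac_det_re_pos_oneSite`).

## Not here

Locality of `D₀` under the admissibility condition `‖1 - U_p‖ < 1/30`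
[HernandezJansenLuscher1999] (a cite fact wanted separately); the index / topological charge
`½ tr ε(H)` and its relation to the spectral flow (see
`Literature.Barriers.QuantumFields.WilsonDeterminantSign`); Berezin integration of overlap quarks.

## References

[Neuberger1998] [Luscher1998] [GinspargWilson1982] [GiustiEtAl2002] [HernandezJansenLuscher1999]
[MontvayMunster1994]
-/

noncomputable section

open Matrix Complex

namespace Literature.MathematicalPhysics.QuantumLattice

/-! ### Matrix analysis behind Ginsparg–Wilson fermions -/

namespace GinspargWilson

variable {n : Type*} [Fintype n] [DecidableEq n]

/-- The matrix sign function `ε(A) = sign(A)` (continuous functional calculus of a Hermitian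
matrix; the junk value `0` if `A` is not Hermitian) is Hermitian. [folklore] -/
theorem isHermitian_cfc_sign (A : Matrix n n ℂ) : (cfc Real.sign A).IsHermitian :=
  (cfc_predicate Real.sign A :)

/-- `ε(A)² = 1` for an invertible Hermitian matrix `A` ("`ε(H)² = 1`", assuming `det H ≠ 0`).
[cite: Neuberger1998, eq. (9)] -/
theorem cfc_sign_mul_self {A : Matrix n n ℂ} (hA : A.IsHermitian) (hdet : A.det ≠ 0) :
    cfc Real.sign A * cfc Real.sign A = 1 := by
  have hA' : IsSelfAdjoint A := hA
  have hcont : ContinuousOn Real.sign (spectrum ℝ A) := A.finite_real_spectrum.continuousOn _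
  have h0 : (0 : ℝ) ∉ spectrum ℝ A :=
    spectrum.zero_notMem ℝ ((Matrix.isUnit_iff_isUnit_det A).mpr (isUnit_iff_ne_zero.mpr hdet))
  rw [← cfc_mul Real.sign Real.sign A hcont hcont]
  calc cfc (fun x => Real.sign x * Real.sign x) A = cfc (fun _ => (1 : ℝ)) A := by
        refine cfc_congr fun x hx => ?_
        have hx0 : x ≠ 0 := fun h => h0 (h ▸ hx)
        rcases Real.sign_apply_eq_of_ne_zero x hx0 with h | h <;> simp [h]
    _ = 1 := cfc_const_one ℝ A

section UnitarySpectrum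

open scoped Matrix.Norms.L2Operator

/-- The spectrum of a unitary matrix lies on the unit circle (proved through the `L²` operator
norm, for which `Matrix n n ℂ` is a C⋆-algebra). [folklore] -/
theorem norm_eq_one_of_mem_spectrum {V : Matrix n n ℂ} (hV : V ∈ Matrix.unitaryGroup n ℂ)
    {z : ℂ} (hz : z ∈ spectrum ℂ V) : ‖z‖ = 1 :=
  spectrum.norm_eq_one_of_unitary hV hz

end UnitarySpectrum

variable (Γ V : Matrix n n ℂ)

/-- `Γ`-hermiticity makes `det(a·1 + b·V)` real: `conj det(a + bV) = det(a + bV†) =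
det(Γ(a + bV)Γ) = det(a + bV)` for `Γ² = 1`, `Γ V Γ = V†`, `a, b ∈ ℝ`. [cite: Neuberger1998, eq. (10)] -/
theorem star_det_smul_one_add_smul (hΓ : Γ * Γ = 1) (hV : Γ * V * Γ = Vᴴ) (a b : ℝ) :
    star (((a : ℂ) • (1 : Matrix n n ℂ) + (b : ℂ) • V).det) =
      ((a : ℂ) • (1 : Matrix n n ℂ) + (b : ℂ) • V).det := by
  have hM : ((a : ℂ) • (1 : Matrix n n ℂ) + (b : ℂ) • V)ᴴ =
      Γ * ((a : ℂ) • (1 : Matrix n n ℂ) + (b : ℂ) • V) * Γ := by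
    rw [conjTranspose_add, conjTranspose_smul, conjTranspose_smul, conjTranspose_one, ← hV]
    simp only [Complex.star_def, Complex.conj_ofReal, Matrix.mul_add, Matrix.add_mul,
      Matrix.mul_smul, Matrix.smul_mul, Matrix.mul_one, hΓ]
  rw [← det_conjTranspose, hM, det_mul, det_mul, mul_comm Γ.det, mul_assoc, ← det_mul, hΓ,
    det_one, mul_one]

/-- The imaginary part of `det(a·1 + b·V)` vanishes under `Γ`-hermiticity. [cite: Neuberger1998, eq. (10)] -/
theorem det_smul_one_add_smul_im (hΓ : Γ * Γ = 1) (hV : Γ * V * Γ = Vᴴ) (a b : ℝ) :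
    (((a : ℂ) • (1 : Matrix n n ℂ) + (b : ℂ) • V).det).im = 0 :=
  Complex.conj_eq_iff_im.mp (star_det_smul_one_add_smul Γ V hΓ hV a b)

/-- For unitary `V` and reals `|c| < a`, `a·1 + c·V` is invertible: otherwise `-a/c` would be
an eigenvalue of `V` of modulus `a/|c| > 1`. [folklore] -/
theorem det_smul_one_add_smul_ne_zero (hVu : V ∈ Matrix.unitaryGroup n ℂ) {a c : ℝ}
    (h : |c| < a) : ((a : ℂ) • (1 : Matrix n n ℂ) + (c : ℂ) • V).det ≠ 0 := by
  have ha : 0 < a := (abs_nonneg c).trans_lt h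
  intro hdet
  rcases eq_or_ne c 0 with rfl | hc
  · simp only [Complex.ofReal_zero, zero_smul, add_zero, det_smul, det_one, mul_one] at hdet
    exact ha.ne' (Complex.ofReal_eq_zero.mp (eq_zero_of_pow_eq_zero hdet))
  · set z : ℂ := ((-a / c : ℝ) : ℂ) with hz
    have hmat : (a : ℂ) • (1 : Matrix n n ℂ) + (c : ℂ) • V = (-(c : ℂ)) • (z • (1 : Matrix n n ℂ) - V) := by
      have hcz : (-(c : ℂ)) * z = a := by
        rw [hz]
        have hc' : (c : ℂ) ≠ 0 := Complex.ofReal_ne_zero.mpr hc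
        push_cast
        field_simp
      rw [smul_sub, smul_smul, hcz, neg_smul, sub_neg_eq_add]
    have hmem : z ∈ spectrum ℂ V := by
      rw [spectrum.mem_iff, Algebra.algebraMap_eq_smul_one, Matrix.isUnit_iff_isUnit_det,
        isUnit_iff_ne_zero, not_not]
      have h2 : ((-(c : ℂ)) • (z • (1 : Matrix n n ℂ) - V)).det = 0 := by rw [← hmat]; exact hdet
      rw [det_smul] at h2
      rcases mul_eq_zero.mp h2 with h3 | h3
      · exact absurd (neg_eq_zero.mp (eq_zero_of_pow_eq_zero h3)) (Complex.ofReal_ne_zero.mpr hc)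
      · exact h3
    have hnorm := norm_eq_one_of_mem_spectrum hVu hmem
    rw [hz, Complex.norm_real, Real.norm_eq_abs, abs_div, abs_neg, abs_of_pos ha,
      div_eq_one_iff_eq (abs_pos.mpr hc).ne'] at hnorm
    linarith

/-- Continuity of `t ↦ Re det(a·1 + t b·V)`. [folklore] -/
theorem continuous_det_smul_one_add_smul_re (a b : ℝ) :
    Continuous fun t : ℝ => (((a : ℂ) • (1 : Matrix n n ℂ) + ((t * b : ℝ) : ℂ) • V).det).re := by
  refine Complex.continuous_re.comp (Continuous.matrix_det ?_)
  exact continuous_const.add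
    ((Complex.continuous_ofReal.comp (continuous_id.mul continuous_const)).smul continuous_const)

/-- **Ginsparg–Wilson positivity (pairing argument, homotopy form).** If `Γ² = 1`, `V` is unitary
and `Γ`-Hermitian (`Γ V Γ = V†`), then `Re det(a·1 + b·V) > 0` for all reals `|b| < a`:
`t ↦ Re det(a + tbV)` is continuous on `[0,1]`, real-valued equal to the determinant, never zero
(`det_smul_one_add_smul_ne_zero`), and equals `aⁿ > 0` at `t = 0`. With `Γ = γ₅`,
`V = γ₅ ε(H)`, `a = 1 + μ/2`, `b = 1 - μ/2` this is `det D_μ > 0` for every `μ > 0`; the source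
prints the limiting case `det(1 + V) = ∏(1+λ_r) ∏|1+λ_c|² ≥ 0`. [cite: Neuberger1998, eq. (10)] -/
theorem det_smul_one_add_smul_re_pos (hΓ : Γ * Γ = 1) (hV : Γ * V * Γ = Vᴴ)
    (hVu : V ∈ Matrix.unitaryGroup n ℂ) {a b : ℝ} (h : |b| < a) :
    0 < (((a : ℂ) • (1 : Matrix n n ℂ) + (b : ℂ) • V).det).re := by
  have ha : 0 < a := (abs_nonneg b).trans_lt h
  have hne : ∀ t ∈ Set.Icc (0 : ℝ) 1,
      (((a : ℂ) • (1 : Matrix n n ℂ) + ((t * b : ℝ) : ℂ) • V).det).re ≠ 0 := by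
    intro t ht hft
    have htb : |t * b| < a := by
      rw [abs_mul, abs_of_nonneg ht.1]
      exact lt_of_le_of_lt (mul_le_of_le_one_left (abs_nonneg b) ht.2) h
    exact det_smul_one_add_smul_ne_zero V hVu htb
      (Complex.ext hft (det_smul_one_add_smul_im Γ V hΓ hV a (t * b)))
  have key := intermediate_value_Icc' (zero_le_one' ℝ)
    (continuous_det_smul_one_add_smul_re V a b).continuousOn
  simp only [one_mul, zero_mul, Complex.ofReal_zero, zero_smul, add_zero, det_smul, det_one,
    mul_one, ← Complex.ofReal_pow, Complex.ofReal_re] at key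
  by_contra hle
  push Not at hle
  obtain ⟨t, ht, hft⟩ := key ⟨hle, (pow_pos ha _).le⟩
  exact hne t ht hft

/-- Item form: `det(a·1 + b·V)` is real and strictly positive. [cite: Neuberger1998, eq. (10)] -/
theorem det_smul_one_add_smul_pos (hΓ : Γ * Γ = 1) (hV : Γ * V * Γ = Vᴴ)
    (hVu : V ∈ Matrix.unitaryGroup n ℂ) {a b : ℝ} (h : |b| < a) :
    0 < (((a : ℂ) • (1 : Matrix n n ℂ) + (b : ℂ) • V).det).re ∧
      (((a : ℂ) • (1 : Matrix n n ℂ) + (b : ℂ) • V).det).im = 0 :=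
  ⟨det_smul_one_add_smul_re_pos Γ V hΓ hV hVu h, det_smul_one_add_smul_im Γ V hΓ hV a b⟩

end GinspargWilson

/-! ### The overlap operator on the four-torus -/

section OverlapFermions

open Literature.Probability.LatticeModels QuantumFieldTheory GinspargWilson

variable {L N : ℕ} [NeZero L] {G : Type*} [Group G] (ρ : G →* Matrix (Fin N) (Fin N) ℂ)

local notation "Γ₅" => (spinorLift gammaFive :
  Matrix (TorusSite 4 L × Fin N × Fin 4) (TorusSite 4 L × Fin N × Fin 4) ℂ)

/-- **The Hermitian Wilson kernel** `H(m₀) = Γ₅ · D_W(U, -m₀, 1)` of the overlap construction: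
`Γ₅` times the `r = 1` Wilson–Dirac operator with NEGATIVE bare mass `-m₀` (projection point
`m₀`, one massless species for `0 < m₀ < 2`). Neuberger's `H⁻ = H(-m₀)` with `Γ H(m) = X(m)` the
Wilson–Dirac operator; the `Q` of Giusti–Hoelbling–Lüscher–Wittig with `1 + s = m₀`.
[cite: Neuberger1998, eqs. (2) and (11)] -/
def overlapKernel (U : GaugeConfig 4 L G) (m₀ : ℝ) :
    Matrix (TorusSite 4 L × Fin N × Fin 4) (TorusSite 4 L × Fin N × Fin 4) ℂ :=
  spinorLift gammaFive * wilsonDirac ρ U (-m₀) 1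

/-- **Neuberger's unitary** `V = Γ₅ ε(H(m₀))`, `ε(H) = H/√H² = sign(H)` taken in Mathlib's
continuous functional calculus of the Hermitian matrix `H` (`cfc Real.sign`; on the exceptional
set `det H = 0` the zero modes of `H` contribute `sign 0 = 0`, and for non-unitary `ρ`, where `H`
is not Hermitian, `cfc` returns the junk value `0`). [cite: Neuberger1998, eq. (9)] -/
def overlapUnitary (U : GaugeConfig 4 L G) (m₀ : ℝ) :
    Matrix (TorusSite 4 L × Fin N × Fin 4) (TorusSite 4 L × Fin N × Fin 4) ℂ :=
  spinorLift gammaFive * cfc Real.sign (overlapKernel ρ U m₀)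

/-- **The massive overlap Dirac operator** (lattice units, `r = 1`, projection point `m₀`,
bare mass `μ`): `D_μ = (1 + μ/2)·1 + (1 - μ/2)·Γ₅ ε(Γ₅ D_W(U, -m₀, 1)) = (1 - μ/2)D₀ + μ`,
`D₀ = 1 + V` (`= 2·(1+V)/2` of Neuberger). At `m₀ = 1` this is the massive Neuberger–Dirac
operator `D_m = (1 - ām/2)D + m`, `D = ā⁻¹(1 + γ₅ sign Q)` at `a = 1`, `s = 0`, `m = μ`; for
general `m₀` it equals `m₀⁻¹ D_m` at `m = m₀μ` (overall factor `1 + s = m₀` omitted).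
[cite: GiustiEtAl2002, §2 eqs. (2.3)–(2.4)] [cite: Neuberger1998, eq. (8)] -/
def overlapDirac (U : GaugeConfig 4 L G) (m₀ μ : ℝ) :
    Matrix (TorusSite 4 L × Fin N × Fin 4) (TorusSite 4 L × Fin N × Fin 4) ℂ :=
  ((1 + μ / 2 : ℝ) : ℂ) • (1 : Matrix _ _ ℂ) + ((1 - μ / 2 : ℝ) : ℂ) • overlapUnitary ρ U m₀

/-- Unfolding: `D_μ = (1 + μ/2)·1 + (1 - μ/2)·(Γ₅ · sign(Γ₅ D_W(U,-m₀,1)))` — syntactically the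
term the route `OverlapPositivityTransfer` inlines (there with `ρ` the fundamental `SU(3)`
representation and `m₀ = 1`). [cite: GiustiEtAl2002, §2 eqs. (2.3)–(2.4)] -/
theorem overlapDirac_def (U : GaugeConfig 4 L G) (m₀ μ : ℝ) :
    overlapDirac ρ U m₀ μ = ((1 + μ / 2 : ℝ) : ℂ) •
        (1 : Matrix (TorusSite 4 L × Fin N × Fin 4) (TorusSite 4 L × Fin N × Fin 4) ℂ) +
      ((1 - μ / 2 : ℝ) : ℂ) •
        (spinorLift gammaFive * cfc Real.sign (spinorLift gammaFive * wilsonDirac ρ U (-m₀) 1)) :=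
  rfl

omit [NeZero L] in
/-- `Γ₅† = Γ₅` (a real diagonal sign matrix in the chiral basis). [folklore] -/
theorem spinorLift_gammaFive_conjTranspose : (Γ₅)ᴴ = Γ₅ := by
  rw [spinorLift_gammaFive_eq_diagonal, diagonal_conjTranspose]
  congr 1
  funext p
  obtain ⟨x, a, α⟩ := p
  fin_cases α <;> simp

/-- **`H(m₀) = Γ₅ D_W(U,-m₀,1)` is Hermitian** for a unitary colour representation
(γ₅-hermiticity of the Wilson–Dirac operator, tree fact `wilsonDirac_gammaFive_hermitian`,
discharged). [cite: MontvayMunster1994, §5.1.2 (5.15)] [cite: Neuberger1998, eq. (2)] -/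
theorem overlapKernel_isHermitian (hρ : ∀ g, ρ g ∈ Matrix.unitaryGroup (Fin N) ℂ)
    (U : GaugeConfig 4 L G) (m₀ : ℝ) : (overlapKernel ρ U m₀).IsHermitian := by
  have hΓ := wilsonDirac_gammaFive_hermitian_holds ρ hρ U (-m₀) 1
  unfold Matrix.IsHermitian overlapKernel
  rw [conjTranspose_mul, spinorLift_gammaFive_conjTranspose, ← hΓ, Matrix.mul_assoc,
    spinorLift_gammaFive_mul_self, Matrix.mul_one]

/-- `ε(H)` is Hermitian. [cite: Neuberger1998, eq. (9)] -/
theorem isHermitian_overlapSign (U : GaugeConfig 4 L G) (m₀ : ℝ) :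
    (cfc Real.sign (overlapKernel ρ U m₀)).IsHermitian :=
  isHermitian_cfc_sign _

/-- **`ε(H)² = 1` off the exceptional set** `det H(m₀) = 0`. [cite: Neuberger1998, eq. (9)] -/
theorem overlapSign_mul_self (hρ : ∀ g, ρ g ∈ Matrix.unitaryGroup (Fin N) ℂ)
    (U : GaugeConfig 4 L G) (m₀ : ℝ) (h0 : (overlapKernel ρ U m₀).det ≠ 0) :
    cfc Real.sign (overlapKernel ρ U m₀) * cfc Real.sign (overlapKernel ρ U m₀) = 1 :=
  cfc_sign_mul_self (overlapKernel_isHermitian ρ hρ U m₀) h0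

/-- `V† = ε(H) Γ₅`. [cite: Neuberger1998, eq. (9)] -/
theorem overlapUnitary_conjTranspose (U : GaugeConfig 4 L G) (m₀ : ℝ) :
    (overlapUnitary ρ U m₀)ᴴ = cfc Real.sign (overlapKernel ρ U m₀) * Γ₅ := by
  rw [overlapUnitary, conjTranspose_mul, spinorLift_gammaFive_conjTranspose,
    (isHermitian_overlapSign ρ U m₀).eq]

/-- **`V` is `Γ₅`-Hermitian**: `Γ₅ V Γ₅ = V†` (both factors of `V = Γ₅ ε(H)` are Hermitian).
[cite: Neuberger1998, eq. (9)] -/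
theorem overlapUnitary_gammaFive_hermitian (U : GaugeConfig 4 L G) (m₀ : ℝ) :
    Γ₅ * overlapUnitary ρ U m₀ * Γ₅ = (overlapUnitary ρ U m₀)ᴴ := by
  rw [overlapUnitary_conjTranspose, overlapUnitary, ← Matrix.mul_assoc,
    spinorLift_gammaFive_mul_self, Matrix.one_mul]

/-- `V† V = 1` off the exceptional set. [cite: Neuberger1998, eq. (9)] -/
theorem overlapUnitary_conjTranspose_mul_self (hρ : ∀ g, ρ g ∈ Matrix.unitaryGroup (Fin N) ℂ)
    (U : GaugeConfig 4 L G) (m₀ : ℝ) (h0 : (overlapKernel ρ U m₀).det ≠ 0) :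
    (overlapUnitary ρ U m₀)ᴴ * overlapUnitary ρ U m₀ = 1 := by
  rw [overlapUnitary_conjTranspose, overlapUnitary, Matrix.mul_assoc,
    ← Matrix.mul_assoc Γ₅, spinorLift_gammaFive_mul_self, Matrix.one_mul,
    overlapSign_mul_self ρ hρ U m₀ h0]

/-- `V V† = 1` off the exceptional set. [cite: Neuberger1998, eq. (9)] -/
theorem overlapUnitary_mul_conjTranspose (hρ : ∀ g, ρ g ∈ Matrix.unitaryGroup (Fin N) ℂ)
    (U : GaugeConfig 4 L G) (m₀ : ℝ) (h0 : (overlapKernel ρ U m₀).det ≠ 0) :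
    overlapUnitary ρ U m₀ * (overlapUnitary ρ U m₀)ᴴ = 1 := by
  rw [overlapUnitary_conjTranspose, overlapUnitary, Matrix.mul_assoc,
    ← Matrix.mul_assoc (cfc Real.sign _), overlapSign_mul_self ρ hρ U m₀ h0, Matrix.one_mul,
    spinorLift_gammaFive_mul_self]

/-- **`V = Γ₅ ε(H)` is unitary** off the exceptional set `det H(m₀) = 0`.
[cite: Neuberger1998, eq. (9)] -/
theorem overlapUnitary_mem_unitaryGroup (hρ : ∀ g, ρ g ∈ Matrix.unitaryGroup (Fin N) ℂ)
    (U : GaugeConfig 4 L G) (m₀ : ℝ) (h0 : (overlapKernel ρ U m₀).det ≠ 0) :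
    overlapUnitary ρ U m₀ ∈ Matrix.unitaryGroup (TorusSite 4 L × Fin N × Fin 4) ℂ := by
  rw [Matrix.mem_unitaryGroup_iff, star_eq_conjTranspose]
  exact overlapUnitary_mul_conjTranspose ρ hρ U m₀ h0

/-- **The spectrum of `V` is unimodular** ("all the eigenvalues of `V` reside on the unit
circle"). [cite: Neuberger1998, text after eq. (14)] -/
theorem overlapUnitary_spectrum_norm_eq_one (hρ : ∀ g, ρ g ∈ Matrix.unitaryGroup (Fin N) ℂ)
    (U : GaugeConfig 4 L G) (m₀ : ℝ) (h0 : (overlapKernel ρ U m₀).det ≠ 0) {z : ℂ}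
    (hz : z ∈ spectrum ℂ (overlapUnitary ρ U m₀)) : ‖z‖ = 1 :=
  norm_eq_one_of_mem_spectrum (overlapUnitary_mem_unitaryGroup ρ hρ U m₀ h0) hz

/-- The massless overlap operator is `D₀ = 1 + V`. [cite: Neuberger1998, eq. (8)] -/
theorem overlapDirac_zero (U : GaugeConfig 4 L G) (m₀ : ℝ) :
    overlapDirac ρ U m₀ 0 = 1 + overlapUnitary ρ U m₀ := by
  simp [overlapDirac]

/-- **Mass decomposition** `D_μ = D₀ + μ(1 - ½D₀)`, i.e. `D_m = (1 - ām/2)D + m` at `ā = 1`.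
[cite: GiustiEtAl2002, §2 eq. (2.3)] -/
theorem overlapDirac_eq_massless_add (U : GaugeConfig 4 L G) (m₀ μ : ℝ) :
    overlapDirac ρ U m₀ μ =
      overlapDirac ρ U m₀ 0 + (μ : ℂ) • (1 - (2⁻¹ : ℂ) • overlapDirac ρ U m₀ 0) := by
  rw [overlapDirac_zero, overlapDirac]
  push_cast
  module

/-- `D_μ† = (1 + μ/2)·1 + (1 - μ/2)·V†`. [folklore] -/
theorem overlapDirac_conjTranspose (U : GaugeConfig 4 L G) (m₀ μ : ℝ) :
    (overlapDirac ρ U m₀ μ)ᴴ =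
      ((1 + μ / 2 : ℝ) : ℂ) • 1 + ((1 - μ / 2 : ℝ) : ℂ) • (overlapUnitary ρ U m₀)ᴴ := by
  rw [overlapDirac, conjTranspose_add, conjTranspose_smul, conjTranspose_smul, conjTranspose_one]
  simp only [Complex.star_def, Complex.conj_ofReal]

/-- **`Γ₅`-hermiticity of the overlap operator**: `Γ₅ D_μ Γ₅ = D_μ†` for every `μ`
(`D† = γ₅ D γ₅`). [cite: GiustiEtAl2002, §2 eq. (2.1)] -/
theorem overlapDirac_gammaFive_hermitian (U : GaugeConfig 4 L G) (m₀ μ : ℝ) :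
    Γ₅ * overlapDirac ρ U m₀ μ * Γ₅ = (overlapDirac ρ U m₀ μ)ᴴ := by
  rw [overlapDirac_conjTranspose, ← overlapUnitary_gammaFive_hermitian, overlapDirac]
  simp only [Matrix.mul_add, Matrix.add_mul, Matrix.mul_smul, Matrix.smul_mul, Matrix.mul_one,
    spinorLift_gammaFive_mul_self, Matrix.mul_assoc]

/-- **The overlap determinant is real**: `Im det D_μ = 0` for every real `μ`
(from `Γ₅`-hermiticity). [cite: Neuberger1998, eq. (10)] -/
theorem overlapDirac_det_im (U : GaugeConfig 4 L G) (m₀ μ : ℝ) :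
    ((overlapDirac ρ U m₀ μ).det).im = 0 :=
  det_smul_one_add_smul_im Γ₅ (overlapUnitary ρ U m₀) spinorLift_gammaFive_mul_self
    (overlapUnitary_gammaFive_hermitian ρ U m₀) _ _

/-- **The Ginsparg–Wilson relation** `γ₅ D₀ + D₀ γ₅ = D₀ γ₅ D₀` for the massless overlap operator
`D₀ = 1 + V` (Lüscher's `γ₅D + Dγ₅ = aDγ₅D` at `a = 1`; the relation is originally due to
Ginsparg and Wilson, 1982), off the exceptional set. [cite: Luscher1998, eq. (3.1)] -/
theorem overlapDirac_ginspargWilson (hρ : ∀ g, ρ g ∈ Matrix.unitaryGroup (Fin N) ℂ)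
    (U : GaugeConfig 4 L G) (m₀ : ℝ) (h0 : (overlapKernel ρ U m₀).det ≠ 0) :
    Γ₅ * overlapDirac ρ U m₀ 0 + overlapDirac ρ U m₀ 0 * Γ₅ =
      overlapDirac ρ U m₀ 0 * Γ₅ * overlapDirac ρ U m₀ 0 := by
  rw [overlapDirac_zero]
  set S := cfc Real.sign (overlapKernel ρ U m₀) with hSdef
  have hS : S * S = 1 := overlapSign_mul_self ρ hρ U m₀ h0
  have hG : Γ₅ * Γ₅ = 1 := spinorLift_gammaFive_mul_self
  have hV : overlapUnitary ρ U m₀ = Γ₅ * S := rfl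
  have h1 : ∀ X : Matrix (TorusSite 4 L × Fin N × Fin 4) (TorusSite 4 L × Fin N × Fin 4) ℂ,
      Γ₅ * (Γ₅ * X) = X := fun X => by rw [← Matrix.mul_assoc, hG, Matrix.one_mul]
  rw [hV]
  simp only [Matrix.mul_add, Matrix.add_mul, Matrix.mul_one, Matrix.one_mul, Matrix.mul_assoc,
    h1, hS]
  abel

/-- **Lüscher's exact chiral symmetry**: with `δψ = γ₅(1 - ½D₀)ψ`, `δψ̄ = ψ̄(1 - ½D₀)γ₅`
(`a = 1`), the variation of the action kernel `ψ̄ D₀ ψ` is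
`(1 - ½D₀)γ₅ D₀ + D₀ γ₅ (1 - ½D₀) = 0` — a restatement of the Ginsparg–Wilson relation.
[cite: Luscher1998, eq. (4.1)] -/
theorem overlapDirac_luscher_symmetry (hρ : ∀ g, ρ g ∈ Matrix.unitaryGroup (Fin N) ℂ)
    (U : GaugeConfig 4 L G) (m₀ : ℝ) (h0 : (overlapKernel ρ U m₀).det ≠ 0) :
    (1 - (2⁻¹ : ℂ) • overlapDirac ρ U m₀ 0) * Γ₅ * overlapDirac ρ U m₀ 0 +
        overlapDirac ρ U m₀ 0 * (Γ₅ * (1 - (2⁻¹ : ℂ) • overlapDirac ρ U m₀ 0)) = 0 := by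
  have hGW := overlapDirac_ginspargWilson ρ hρ U m₀ h0
  set D := overlapDirac ρ U m₀ 0
  have hGW' : D * (Γ₅ * D) = Γ₅ * D + D * Γ₅ := by rw [← Matrix.mul_assoc]; exact hGW.symm
  simp only [Matrix.sub_mul, Matrix.mul_sub, Matrix.one_mul, Matrix.mul_one, Matrix.smul_mul,
    Matrix.mul_smul, Matrix.mul_assoc, hGW', smul_add]
  module

/-- **`D_μ` is normal** off the exceptional set (`V` unitary). [folklore] -/
theorem overlapDirac_isStarNormal (hρ : ∀ g, ρ g ∈ Matrix.unitaryGroup (Fin N) ℂ)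
    (U : GaugeConfig 4 L G) (m₀ μ : ℝ) (h0 : (overlapKernel ρ U m₀).det ≠ 0) :
    IsStarNormal (overlapDirac ρ U m₀ μ) := by
  have h1 := overlapUnitary_mul_conjTranspose ρ hρ U m₀ h0
  have h2 := overlapUnitary_conjTranspose_mul_self ρ hρ U m₀ h0
  refine ⟨?_⟩
  rw [Commute, SemiconjBy, star_eq_conjTranspose, overlapDirac_conjTranspose, overlapDirac]
  simp only [Matrix.mul_add, Matrix.add_mul, Matrix.mul_smul, Matrix.smul_mul, Matrix.mul_one,
    Matrix.one_mul, h1, h2]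
  module

/-- **Spectrum on the Ginsparg–Wilson circle**: every `z ∈ spec D₀` has `|z - 1| = 1`
("all the eigenvalues of `V` reside on the unit circle"). [cite: Neuberger1998, text after eq. (14)] -/
theorem overlapDirac_zero_spectrum (hρ : ∀ g, ρ g ∈ Matrix.unitaryGroup (Fin N) ℂ)
    (U : GaugeConfig 4 L G) (m₀ : ℝ) (h0 : (overlapKernel ρ U m₀).det ≠ 0) {z : ℂ}
    (hz : z ∈ spectrum ℂ (overlapDirac ρ U m₀ 0)) : ‖z - 1‖ = 1 := by
  rw [overlapDirac_zero,
    ← map_one (algebraMap ℂ (Matrix (TorusSite 4 L × Fin N × Fin 4)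
      (TorusSite 4 L × Fin N × Fin 4) ℂ)),
    ← spectrum.singleton_add_eq, Set.singleton_add] at hz
  obtain ⟨w, hw, rfl⟩ := hz
  rw [add_sub_cancel_left]
  exact overlapUnitary_spectrum_norm_eq_one ρ hρ U m₀ h0 hw

/-- **`D_μ† D_μ = μ² + (1 - μ²/4) D₀† D₀`** off the exceptional set (`V` unitary; elementary
algebra on `D_μ = (1 + μ/2) + (1 - μ/2)V`). [folklore] -/
theorem overlapDirac_conjTranspose_mul_self (hρ : ∀ g, ρ g ∈ Matrix.unitaryGroup (Fin N) ℂ)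
    (U : GaugeConfig 4 L G) (m₀ μ : ℝ) (h0 : (overlapKernel ρ U m₀).det ≠ 0) :
    (overlapDirac ρ U m₀ μ)ᴴ * overlapDirac ρ U m₀ μ =
      ((μ ^ 2 : ℝ) : ℂ) • 1 +
        ((1 - μ ^ 2 / 4 : ℝ) : ℂ) • ((overlapDirac ρ U m₀ 0)ᴴ * overlapDirac ρ U m₀ 0) := by
  have h2 := overlapUnitary_conjTranspose_mul_self ρ hρ U m₀ h0
  rw [overlapDirac_conjTranspose, overlapDirac_conjTranspose, overlapDirac, overlapDirac]
  push_cast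
  simp only [Matrix.mul_add, Matrix.add_mul, Matrix.mul_smul, Matrix.smul_mul, Matrix.mul_one,
    Matrix.one_mul, h2, smul_add, smul_smul]
  module

open scoped ComplexOrder in
/-- **Resolvent bound** `D_μ† D_μ - μ² ≥ 0` (Loewner order) for `0 ≤ μ ≤ 2` (indeed `|μ| ≤ 2`),
off the exceptional set: `‖D_μ ψ‖ ≥ μ‖ψ‖`, so `‖D_μ⁻¹‖ ≤ 1/μ`. [folklore] -/
theorem posSemidef_overlapDirac_sub (hρ : ∀ g, ρ g ∈ Matrix.unitaryGroup (Fin N) ℂ)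
    (U : GaugeConfig 4 L G) (m₀ : ℝ) {μ : ℝ} (hμ : μ ^ 2 ≤ 4)
    (h0 : (overlapKernel ρ U m₀).det ≠ 0) :
    ((overlapDirac ρ U m₀ μ)ᴴ * overlapDirac ρ U m₀ μ - ((μ ^ 2 : ℝ) : ℂ) • 1).PosSemidef := by
  rw [overlapDirac_conjTranspose_mul_self ρ hρ U m₀ μ h0, add_sub_cancel_left]
  exact (posSemidef_conjTranspose_mul_self _).smul (Complex.zero_le_real.mpr (by linarith))

/-- **Positivity of the massive overlap determinant**: `Re det D_μ > 0` (and `det D_μ` is real)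
for every `μ > 0`, off the exceptional set. [cite: Neuberger1998, eq. (10)] -/
theorem overlapDirac_det_re_pos (hρ : ∀ g, ρ g ∈ Matrix.unitaryGroup (Fin N) ℂ)
    (U : GaugeConfig 4 L G) (m₀ : ℝ) {μ : ℝ} (hμ : 0 < μ)
    (h0 : (overlapKernel ρ U m₀).det ≠ 0) : 0 < ((overlapDirac ρ U m₀ μ).det).re :=
  det_smul_one_add_smul_re_pos Γ₅ (overlapUnitary ρ U m₀) spinorLift_gammaFive_mul_self
    (overlapUnitary_gammaFive_hermitian ρ U m₀) (overlapUnitary_mem_unitaryGroup ρ hρ U m₀ h0)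
    (by rw [abs_sub_lt_iff]; constructor <;> linarith)

/-- **`det D₀ = det(1 + V) ≥ 0`** for the massless operator, off the exceptional set
(limit `μ → 0⁺` of `overlapDirac_det_re_pos`). [cite: Neuberger1998, eq. (10)] -/
theorem overlapDirac_zero_det_re_nonneg (hρ : ∀ g, ρ g ∈ Matrix.unitaryGroup (Fin N) ℂ)
    (U : GaugeConfig 4 L G) (m₀ : ℝ) (h0 : (overlapKernel ρ U m₀).det ≠ 0) :
    0 ≤ ((overlapDirac ρ U m₀ 0).det).re := by
  have hcont : Continuous fun μ : ℝ => ((overlapDirac ρ U m₀ μ).det).re := by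
    refine Complex.continuous_re.comp (Continuous.matrix_det ?_)
    unfold overlapDirac
    fun_prop
  have ht : Filter.Tendsto (fun μ : ℝ => ((overlapDirac ρ U m₀ μ).det).re)
      (nhdsWithin 0 (Set.Ioi 0)) (nhds ((overlapDirac ρ U m₀ 0).det).re) :=
    (hcont.tendsto 0).mono_left nhdsWithin_le_nhds
  refine ge_of_tendsto ht ?_
  filter_upwards [self_mem_nhdsWithin] with μ hμ
  exact (overlapDirac_det_re_pos ρ hρ U m₀ hμ h0).le

end OverlapFermions

/-! ### Non-vacuity of the exceptional-set hypothesis -/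

section FreeField

open Literature.Probability.LatticeModels QuantumFieldTheory

variable {N : ℕ} {G : Type*} [Group G] (ρ : G →* Matrix (Fin N) (Fin N) ℂ)

/-- On the one-site torus `L = 1`, in the trivial gauge field `U ≡ 1`, the Wilson–Dirac operator
is its mass term: `D_W(1, m, r) = m·1` (each direction contributes `½[(r - γ_μ) + (r + γ_μ)] = r`
on the diagonal, cancelling the `4r`). [folklore] -/
theorem wilsonDirac_one_oneSite (m r : ℝ) :
    wilsonDirac (L := 1) ρ (fun _ => 1) m r =
      (m : ℂ) • (1 : Matrix (TorusSite 4 1 × Fin N × Fin 4) (TorusSite 4 1 × Fin N × Fin 4) ℂ) := by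
  ext p q
  obtain ⟨x, a, α⟩ := p
  obtain ⟨y, b, β⟩ := q
  have hxy : x = y := Subsingleton.elim _ _
  subst hxy
  have hshift : ∀ μ : Fin 4, QuantumFieldTheory.Site.shift x μ = x := fun μ => Subsingleton.elim _ _
  simp only [wilsonDirac, Matrix.of_apply, hshift, if_true, map_one, inv_one, Matrix.smul_apply,
    Matrix.one_apply, Prod.mk.injEq, true_and, Matrix.sub_apply, Matrix.add_apply, smul_eq_mul]
  have hsum : ∀ μ : Fin 4,
      ((((r : ℂ) * if α = β then 1 else 0) - euclideanGamma μ α β) * if a = b then 1 else 0) +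
        (((r : ℂ) * if α = β then 1 else 0) + euclideanGamma μ α β) * (if a = b then 1 else 0) =
      2 * r * (if α = β then 1 else 0) * (if a = b then 1 else 0) := fun μ => by ring
  simp only [hsum, Finset.sum_const, Finset.card_univ, Fintype.card_fin, nsmul_eq_mul, Nat.cast_ofNat]
  by_cases hab : a = b
  · by_cases hαβ : α = β
    · simp only [hab, hαβ, and_self, if_true, mul_one]
      push_cast
      ring
    · simp [hab, hαβ]
  · simp [hab]

/-- **The exceptional-set hypothesis `det H(m₀) ≠ 0` is satisfiable**: on the one-site torus in
the trivial gauge field `H(m₀) = Γ₅ · (-m₀·1)`, whose determinant `(-m₀)^{4N} det Γ₅` is non-zero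
for every `m₀ ≠ 0` (`det Γ₅ ≠ 0` as `Γ₅² = 1`). [folklore] -/
theorem overlapKernel_det_ne_zero_oneSite {m₀ : ℝ} (hm : m₀ ≠ 0) :
    (overlapKernel (L := 1) ρ (fun _ => 1) m₀).det ≠ 0 := by
  have hΓ : ((spinorLift gammaFive :
      Matrix (TorusSite 4 1 × Fin N × Fin 4) (TorusSite 4 1 × Fin N × Fin 4) ℂ)).det ≠ 0 := by
    intro h
    have h1 := congrArg Matrix.det (spinorLift_gammaFive_mul_self (L := 1) (N := N))
    rw [det_mul, h, zero_mul, det_one] at h1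
    exact zero_ne_one h1
  rw [overlapKernel, wilsonDirac_one_oneSite, det_mul, det_smul, det_one, mul_one]
  refine mul_ne_zero hΓ (pow_ne_zero _ ?_)
  exact_mod_cast neg_ne_zero.mpr hm

/-- Hence, on that configuration, `V = Γ₅ ε(H)` IS unitary and `det D_μ > 0` for `μ > 0`
(instances of the conditional API of `OverlapDirac.lean`, for any colour representation by
unitary matrices). [cite: Neuberger1998, eqs. (9)–(10)] -/
theorem overlapDirac_det_re_pos_oneSite (hρ : ∀ g, ρ g ∈ Matrix.unitaryGroup (Fin N) ℂ)
    {m₀ μ : ℝ} (hm : m₀ ≠ 0) (hμ : 0 < μ) :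
    overlapUnitary (L := 1) ρ (fun _ => 1) m₀ ∈
        Matrix.unitaryGroup (TorusSite 4 1 × Fin N × Fin 4) ℂ ∧
      0 < ((overlapDirac (L := 1) ρ (fun _ => 1) m₀ μ).det).re :=
  ⟨overlapUnitary_mem_unitaryGroup ρ hρ _ m₀ (overlapKernel_det_ne_zero_oneSite ρ hm),
    overlapDirac_det_re_pos ρ hρ _ m₀ hμ (overlapKernel_det_ne_zero_oneSite ρ hm)⟩

end FreeField

end Literature.MathematicalPhysics.QuantumLattice

end
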